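import Summits.Ventures.LatticeQCDFlow.Scaling.SwapAcceptanceLaw

/-!
HONEST FRAMING: exact (Metropolis-corrected) sampling algorithms for lattice gauge theory; figures
of merit are autocorrelation/cost numbers at stated couplings and volumes; no continuum-physics
claim.

# SwapLogRatioMoments — THE EXACT FIRST TWO MOMENTS OF THE SWAP LOG-RATIO `ΔS` IN A LINEAR TEMPERING FAMILY:
# `⟨ΔS⟩ = (t−s)(ψ′(t) − ψ′(s)) = (t−s)∫_s^t Var`, `Var ΔS = (t−s)²(Var_s + Var_t)`, `⟨e^{−ΔS}⟩ = 1`; THE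
# EXACTNESS-CONSISTENT GAUSSIAN SWAP MODEL (`Var ΔS = 2⟨ΔS⟩`) IS CORRECT TO LEADING ORDER IN THE GAP, AND
# OVER-STATES (UNDER-STATES) `Var ΔS` WHERE THE VARIANCE PROFILE IS CONCAVE (CONVEX)
# (row 22 `su3-ptbc`, GEN-8, ours)

Venture `LatticeQCDFlow` (cell pub-lqcd), topic `Scaling`; FANOUT row 22 (`su3-ptbc`).  NEW WORK of the cell over
lean-2's `Scaling/SwapAcceptanceLaw` (the bounded exponential family `μ_u = μ.tilted(u·X)`, `ψ = cgf X μ`,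
`∫ X dμ_u = ψ′(u)`, `(ψ′)′(u) = Var_{μ_u} X`, `integral_exp_mul_tilted`, `integral_sub_sq_prod_tilted`) and Mathlib
(`intervalIntegral.integral_eq_sub_of_hasDerivAt`, `ConvexOn`/`ConcaveOn`).  Nothing is cited as a fact; no
`native_decide`.

THE POINT.  Row 22's ladder model (`SwapSpacingOptimum` … `SwapLadderIndexTauIntThreshold`) rests on the Gaussian swap
model: the swap log-ratio `ΔS` of a replica pair is `N(v/2, v)` — the only Gaussian with `⟨e^{−ΔS}⟩ = 1` — so that the
pair acceptance is `erfc(√v/(2√2))` and `√v` is the pair's "stiffness gap".  For the PTBC family the tempered actions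
are LINEAR in the defect parameter, `S_u = S_0 − u·X` (`X = −`defect action; any bounded statistic here), i.e. the
replica laws form the exponential family `μ_u ∝ e^{uX}μ`; the swap between the replicas at `s` and `t` (states `x ~ μ_s`,
`y ~ μ_t`, independent at stationarity) has log-ratio `ΔS = (t−s)(X y − X x)` (`swapLogRatio`; the Metropolis test of
`Exactness/PTBCSwap` / `SwapAcceptanceLaw.swapAcc` is `min(1, e^{−ΔS})`).  What is EXACT, for every such family:

* §1 **`integral_swapLogRatio`**: `⟨ΔS⟩ = (t−s)·(ψ′(t) − ψ′(s))` (the mean statistic rises with the tilt);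
  **`integral_swapLogRatio_eq_intervalIntegral`**: `= (t−s)·∫_s^t Var_{μ_u}(X) du` (so `⟨ΔS⟩ ≥ 0`, and
  `m(t−s)² ≤ ⟨ΔS⟩ ≤ M(t−s)²` under a variance floor / ceiling on `[s,t]`); the right-hand side is the symmetrised
  relative entropy (Jeffreys divergence) of `μ_s, μ_t` — the Bregman identity of `Scaling/TiltKLDivergence` /
  `TrivializingMaps/CouplingKLAnyGroup`, not imported here.
* §2 **`integral_exp_neg_swapLogRatio`**: `⟨e^{−ΔS}⟩ = 1` (the cgf form of `Exactness/PTBCSwapMonitor`'s identity);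
  **`integral_swapLogRatio_sq`** / **`variance_swapLogRatio`**: `⟨ΔS²⟩ = (t−s)²(Var_s + Var_t + (ψ′(t)−ψ′(s))²)`,
  `Var ΔS = (t−s)²·(Var_s + Var_t)` — the pair's exact stiffness gap is `|t−s|·√(Var_s + Var_t)`: a no-swap variance
  scan of the tempered statistic predicts every pair's model acceptance (the card's canary-D recipe).
* §3 THE GAUSSIAN-CONSISTENCY DEFECT `Var ΔS − 2⟨ΔS⟩ = (t−s)²(Var_s + Var_t) − 2(t−s)∫_s^t Var` is `2(t−s)`×(trapezoid
  minus integral of the variance profile on `[s,t]`): **`variance_le_two_mul_integral_of_concaveOn`** (`≤ 0` where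
  `u ↦ Var_{μ_u}X` is concave), **`two_mul_integral_le_variance_of_convexOn`** (`≥ 0` where convex), `= 0` where affine;
  and to LEADING ORDER it vanishes for every family: **`tendsto_integral_swapLogRatio_div_sq`** (`⟨ΔS⟩/(t−s)² → Var_s`)
  and **`tendsto_variance_swapLogRatio_div_sq`** (`Var ΔS/(t−s)² → 2·Var_s`) as `t → s` — close replicas see exactly the
  one-parameter Gaussian relation `Var ΔS = 2⟨ΔS⟩`, which is where an equal-acceptance ladder lives.

Reading for the card (value-free): per pair, the swap log records (`dS` in `records.jsonl`) give two model-free numbers,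
`⟨dS⟩` and `Var dS`; exactly `⟨dS⟩ = δ·∫Var` and `Var dS = δ²(Var_s + Var_t)`, and the Gaussian swap model used for
tuning is consistent with them iff `Var dS ≈ 2⟨dS⟩` — a cheap REPORT-ONLY diagnostic of the model behind the 20 % rule,
beside the sign rule of `Exactness/PTBCSwapSignRule`.  NOT CLAIMED: Gaussianity of `ΔS`, any acceptance formula, any
number of a run.
-/

noncomputable section

open MeasureTheory ProbabilityTheory Real Set Filter Topology intervalIntegral

namespace Summit.Ventures.LatticeQCDFlow.Scaling

variable {Ω : Type*} [MeasurableSpace Ω] {μ : Measure Ω} [IsProbabilityMeasure μ] {X : Ω → ℝ}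

/-! ## §1 The swap log-ratio and its mean -/

section Mean

/-- **The swap log-ratio** of the replica pair at tilts `s`, `t` holding the states `p.1 ~ μ_s`, `p.2 ~ μ_t`:
`ΔS(x, y) = (t − s)(X y − X x)` (actions `S_u = S_0 − u·X`; the swap's Metropolis test is `min(1, e^{−ΔS})`). [ours] -/
def swapLogRatio (X : Ω → ℝ) (s t : ℝ) (p : Ω × Ω) : ℝ := (t - s) * (X p.2 - X p.1)

omit [MeasurableSpace Ω] [IsProbabilityMeasure μ] in
/-- `swapLogRatio`, unfolded. [ours] -/
theorem swapLogRatio_apply (s t : ℝ) (p : Ω × Ω) : swapLogRatio X s t p = (t - s) * (X p.2 - X p.1) := rfl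

omit [MeasurableSpace Ω] [IsProbabilityMeasure μ] in
/-- The integrand of `swapAcc` is `min(1, e^{−ΔS})`. [ours] -/
theorem swapIntegrand_eq_min_exp_neg (s t : ℝ) (p : Ω × Ω) :
    min 1 (exp ((t - s) * (X p.1 - X p.2))) = min 1 (exp (-swapLogRatio X s t p)) := by
  rw [swapLogRatio_apply]; congr 2; ring

omit [IsProbabilityMeasure μ] in
/-- `ΔS` is measurable. [ours] -/
theorem measurable_swapLogRatio (hXm : Measurable X) (s t : ℝ) : Measurable (swapLogRatio X s t) :=
  measurable_const.mul ((hXm.comp measurable_snd).sub (hXm.comp measurable_fst))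

omit [MeasurableSpace Ω] [IsProbabilityMeasure μ] in
/-- `|ΔS| ≤ |t−s|·2C` when `|X| ≤ C`. [ours] -/
theorem abs_swapLogRatio_le {C : ℝ} (hC : ∀ ω, |X ω| ≤ C) (s t : ℝ) (p : Ω × Ω) :
    |swapLogRatio X s t p| ≤ |t - s| * (2 * C) := by
  rw [swapLogRatio_apply, abs_mul]
  refine mul_le_mul_of_nonneg_left ?_ (abs_nonneg _)
  calc |X p.2 - X p.1| ≤ |X p.2| + |X p.1| := abs_sub _ _
    _ ≤ C + C := add_le_add (hC _) (hC _)
    _ = 2 * C := by ring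

/-- **`⟨ΔS⟩ = (t − s)·(ψ′(t) − ψ′(s))`** under `μ_s ⊗ μ_t` (`ψ = cgf X μ`, `∫ X dμ_u = ψ′(u)`). [ours] -/
theorem integral_swapLogRatio (hXm : Measurable X) (hXb : ∃ C, ∀ ω, |X ω| ≤ C) (s t : ℝ) :
    ∫ p, swapLogRatio X s t p ∂((μ.tilted fun ω => s * X ω).prod (μ.tilted fun ω => t * X ω))
      = (t - s) * (deriv (cgf X μ) t - deriv (cgf X μ) s) := by
  haveI := isProbabilityMeasure_tilted_mul (μ := μ) hXm hXb s
  haveI := isProbabilityMeasure_tilted_mul (μ := μ) hXm hXb t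
  obtain ⟨C, hC⟩ := hXb
  have hi : ∀ u : ℝ, Integrable X (μ.tilted fun ω => u * X ω) := fun u => integrable_of_abs_le hXm hC
  simp only [swapLogRatio_apply]
  rw [MeasureTheory.integral_const_mul, integral_sub ((hi t).comp_snd _) ((hi s).comp_fst _), integral_fun_snd, integral_fun_fst,
    probReal_univ, probReal_univ, one_smul, one_smul, integral_tilted_eq_deriv_cgf hXm ⟨C, hC⟩,
    integral_tilted_eq_deriv_cgf hXm ⟨C, hC⟩]

/-- `u ↦ Var_{μ_u}(X)` is continuous (it is `ψ″`, `ψ` analytic). [ours] -/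
theorem continuous_variance_tilted (hXm : Measurable X) (hXb : ∃ C, ∀ ω, |X ω| ≤ C) :
    Continuous fun u : ℝ => variance X (μ.tilted fun ω => u * X ω) := by
  have hA := ((analyticOnNhd_cgf_of_bounded (μ := μ) hXm hXb).deriv).deriv
  have hc : Continuous (deriv (deriv (cgf X μ))) := continuousOn_univ.1 hA.continuousOn
  refine hc.congr fun u => ?_
  exact (hasDerivAt_deriv_cgf_of_bounded (μ := μ) hXm hXb u).deriv

/-- `ψ′(t) − ψ′(s) = ∫_s^t Var_{μ_u}(X) du`. [ours] -/
theorem deriv_cgf_sub_eq_intervalIntegral (hXm : Measurable X) (hXb : ∃ C, ∀ ω, |X ω| ≤ C) (s t : ℝ) :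
    deriv (cgf X μ) t - deriv (cgf X μ) s = ∫ u in s..t, variance X (μ.tilted fun ω => u * X ω) :=
  (integral_eq_sub_of_hasDerivAt (fun u _ => hasDerivAt_deriv_cgf_of_bounded hXm hXb u)
    ((continuous_variance_tilted hXm hXb).intervalIntegrable s t)).symm

/-- **`⟨ΔS⟩ = (t − s)·∫_s^t Var_{μ_u}(X) du`.** [ours] -/
theorem integral_swapLogRatio_eq_intervalIntegral (hXm : Measurable X) (hXb : ∃ C, ∀ ω, |X ω| ≤ C) (s t : ℝ) :
    ∫ p, swapLogRatio X s t p ∂((μ.tilted fun ω => s * X ω).prod (μ.tilted fun ω => t * X ω))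
      = (t - s) * ∫ u in s..t, variance X (μ.tilted fun ω => u * X ω) := by
  rw [integral_swapLogRatio hXm hXb, deriv_cgf_sub_eq_intervalIntegral hXm hXb]

/-- **`⟨ΔS⟩ ≥ 0`** for every pair of tilts (`PTBCSwapMonitor`'s Jensen consequence, here with the formula). [ours] -/
theorem integral_swapLogRatio_nonneg (hXm : Measurable X) (hXb : ∃ C, ∀ ω, |X ω| ≤ C) (s t : ℝ) :
    0 ≤ ∫ p, swapLogRatio X s t p ∂((μ.tilted fun ω => s * X ω).prod (μ.tilted fun ω => t * X ω)) := by
  rw [integral_swapLogRatio_eq_intervalIntegral hXm hXb]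
  have hV : ∀ u, 0 ≤ variance X (μ.tilted fun ω => u * X ω) := fun u => variance_nonneg _ _
  rcases le_total s t with hst | hts
  · exact mul_nonneg (sub_nonneg.2 hst) (intervalIntegral.integral_nonneg (μ := volume) hst fun u _ => hV u)
  · have h : 0 ≤ ∫ u in t..s, variance X (μ.tilted fun ω => u * X ω) :=
      intervalIntegral.integral_nonneg hts fun u _ => hV u
    rw [integral_symm] at h
    nlinarith [h, sub_nonpos.2 hts]

/-- **Variance floor ⇒ `m(t−s)² ≤ ⟨ΔS⟩`** (`s ≤ t`, `m ≤ Var_{μ_u}X` on `[s,t]`). [ours] -/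
theorem mul_sq_le_integral_swapLogRatio (hXm : Measurable X) (hXb : ∃ C, ∀ ω, |X ω| ≤ C) {s t m : ℝ}
    (hst : s ≤ t) (hm : ∀ u ∈ Icc s t, m ≤ variance X (μ.tilted fun ω => u * X ω)) :
    m * (t - s) ^ 2
      ≤ ∫ p, swapLogRatio X s t p ∂((μ.tilted fun ω => s * X ω).prod (μ.tilted fun ω => t * X ω)) := by
  rw [integral_swapLogRatio_eq_intervalIntegral hXm hXb]
  have h : m * (t - s) ≤ ∫ u in s..t, variance X (μ.tilted fun ω => u * X ω) := by
    have := intervalIntegral.integral_mono_on (μ := volume) hst intervalIntegrable_const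
      ((continuous_variance_tilted hXm hXb).intervalIntegrable s t) hm
    rwa [intervalIntegral.integral_const, smul_eq_mul, mul_comm] at this
  nlinarith [sub_nonneg.2 hst]

/-- **Variance ceiling ⇒ `⟨ΔS⟩ ≤ M(t−s)²`** (`s ≤ t`, `Var_{μ_u}X ≤ M` on `[s,t]`). [ours] -/
theorem integral_swapLogRatio_le_mul_sq (hXm : Measurable X) (hXb : ∃ C, ∀ ω, |X ω| ≤ C) {s t M : ℝ}
    (hst : s ≤ t) (hM : ∀ u ∈ Icc s t, variance X (μ.tilted fun ω => u * X ω) ≤ M) :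
    ∫ p, swapLogRatio X s t p ∂((μ.tilted fun ω => s * X ω).prod (μ.tilted fun ω => t * X ω))
      ≤ M * (t - s) ^ 2 := by
  rw [integral_swapLogRatio_eq_intervalIntegral hXm hXb]
  have h : ∫ u in s..t, variance X (μ.tilted fun ω => u * X ω) ≤ M * (t - s) := by
    have := intervalIntegral.integral_mono_on (μ := volume) hst
      ((continuous_variance_tilted hXm hXb).intervalIntegrable s t) intervalIntegrable_const hM
    rwa [intervalIntegral.integral_const, smul_eq_mul, mul_comm] at this
  nlinarith [sub_nonneg.2 hst]

end Mean

/-! ## §2 `⟨e^{−ΔS}⟩ = 1` and the exact variance of `ΔS` -/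

section Second

/-- **`⟨e^{−ΔS}⟩ = 1`**: `∫∫ e^{−(t−s)(X y − X x)} dμ_s dμ_t = (mgf(t)/mgf(s))·(mgf(s)/mgf(t)) = 1`. [ours] -/
theorem integral_exp_neg_swapLogRatio (hXm : Measurable X) (hXb : ∃ C, ∀ ω, |X ω| ≤ C) (s t : ℝ) :
    ∫ p, exp (-swapLogRatio X s t p) ∂((μ.tilted fun ω => s * X ω).prod (μ.tilted fun ω => t * X ω)) = 1 := by
  have e : (fun p : Ω × Ω => exp (-swapLogRatio X s t p))
      = fun p => exp ((t - s) * X p.1) * exp (-(t - s) * X p.2) := by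
    funext p; rw [swapLogRatio_apply, ← exp_add]; congr 1; ring
  rw [e, integral_prod_mul (f := fun x => exp ((t - s) * X x)) (g := fun y => exp (-(t - s) * X y)),
    integral_exp_mul_tilted, integral_exp_mul_tilted]
  have h1 : s + (t - s) = t := by ring
  have h2 : t + -(t - s) = s := by ring
  rw [h1, h2]
  have hs := mgf_pos_of_bounded (μ := μ) hXm hXb s
  have ht := mgf_pos_of_bounded (μ := μ) hXm hXb t
  field_simp

/-- **`⟨ΔS²⟩ = (t−s)²·(Var_s + Var_t + (ψ′(t) − ψ′(s))²)`** (lean-2's exact second moment of `X x − X y`). [ours] -/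
theorem integral_swapLogRatio_sq (hXm : Measurable X) (hXb : ∃ C, ∀ ω, |X ω| ≤ C) (s t : ℝ) :
    ∫ p, swapLogRatio X s t p ^ 2 ∂((μ.tilted fun ω => s * X ω).prod (μ.tilted fun ω => t * X ω))
      = (t - s) ^ 2 * (variance X (μ.tilted fun ω => s * X ω) + variance X (μ.tilted fun ω => t * X ω)
          + (deriv (cgf X μ) t - deriv (cgf X μ) s) ^ 2) := by
  have e : (fun p : Ω × Ω => swapLogRatio X s t p ^ 2) = fun p => (t - s) ^ 2 * (X p.1 - X p.2) ^ 2 := by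
    funext p; rw [swapLogRatio_apply]; ring
  rw [e, MeasureTheory.integral_const_mul, integral_sub_sq_prod_tilted hXm hXb, integral_tilted_eq_deriv_cgf hXm hXb,
    integral_tilted_eq_deriv_cgf hXm hXb]
  ring

/-- **`Var ΔS = (t−s)²·(Var_s + Var_t)`** under `μ_s ⊗ μ_t` — the pair's exact stiffness gap is
`|t−s|·√(Var_{μ_s}X + Var_{μ_t}X)`. [ours] -/
theorem variance_swapLogRatio (hXm : Measurable X) (hXb : ∃ C, ∀ ω, |X ω| ≤ C) (s t : ℝ) :
    variance (swapLogRatio X s t) ((μ.tilted fun ω => s * X ω).prod (μ.tilted fun ω => t * X ω))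
      = (t - s) ^ 2 * (variance X (μ.tilted fun ω => s * X ω) + variance X (μ.tilted fun ω => t * X ω)) := by
  haveI := isProbabilityMeasure_tilted_mul (μ := μ) hXm hXb s
  haveI := isProbabilityMeasure_tilted_mul (μ := μ) hXm hXb t
  obtain ⟨C, hC⟩ := hXb
  have hmem : MemLp (swapLogRatio X s t) 2 ((μ.tilted fun ω => s * X ω).prod (μ.tilted fun ω => t * X ω)) :=
    memLp_of_bounded (a := -(|t - s| * (2 * C))) (b := |t - s| * (2 * C))
      (ae_of_all _ fun p => ⟨(abs_le.1 (abs_swapLogRatio_le hC s t p)).1, (abs_le.1 (abs_swapLogRatio_le hC s t p)).2⟩)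
      (measurable_swapLogRatio hXm s t).aestronglyMeasurable 2
  rw [variance_eq_sub hmem]
  simp only [Pi.pow_apply]
  rw [integral_swapLogRatio_sq hXm ⟨C, hC⟩, integral_swapLogRatio hXm ⟨C, hC⟩]
  ring

/-- `Var ΔS` is symmetric in the pair and nonnegative; its square root, the exact stiffness gap. [ours] -/
theorem sqrt_variance_swapLogRatio (hXm : Measurable X) (hXb : ∃ C, ∀ ω, |X ω| ≤ C) (s t : ℝ) :
    sqrt (variance (swapLogRatio X s t) ((μ.tilted fun ω => s * X ω).prod (μ.tilted fun ω => t * X ω)))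
      = |t - s| * sqrt (variance X (μ.tilted fun ω => s * X ω) + variance X (μ.tilted fun ω => t * X ω)) := by
  rw [variance_swapLogRatio hXm hXb, sqrt_mul (sq_nonneg _), sqrt_sq_eq_abs]

end Second

/-! ## §3 The Gaussian-consistency defect `Var ΔS − 2⟨ΔS⟩`: sign under convexity / concavity of the variance
profile, and the leading order -/

section Gauss

/-- **THE DEFECT IS A TRAPEZOID ERROR**: `Var ΔS − 2⟨ΔS⟩ = (t−s)·((t−s)(Var_s + Var_t) − 2∫_s^t Var_u du)`. [ours] -/
theorem variance_sub_two_mul_integral_swapLogRatio (hXm : Measurable X) (hXb : ∃ C, ∀ ω, |X ω| ≤ C) (s t : ℝ) :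
    variance (swapLogRatio X s t) ((μ.tilted fun ω => s * X ω).prod (μ.tilted fun ω => t * X ω))
        - 2 * ∫ p, swapLogRatio X s t p ∂((μ.tilted fun ω => s * X ω).prod (μ.tilted fun ω => t * X ω))
      = (t - s) * ((t - s) * (variance X (μ.tilted fun ω => s * X ω) + variance X (μ.tilted fun ω => t * X ω))
          - 2 * ∫ u in s..t, variance X (μ.tilted fun ω => u * X ω)) := by
  rw [variance_swapLogRatio hXm hXb, integral_swapLogRatio_eq_intervalIntegral hXm hXb]
  ring

/-- The chord of a concave function lies below it, so the integral dominates the trapezoid: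
`(b − a)(f a + f b)/2 ≤ ∫_a^b f` for `f` continuous and concave on `[a,b]`. [folklore] -/
theorem trapezoid_le_integral_of_concaveOn {f : ℝ → ℝ} {a b : ℝ} (hab : a ≤ b) (hf : Continuous f)
    (hc : ConcaveOn ℝ (Icc a b) f) : (b - a) * (f a + f b) / 2 ≤ ∫ u in a..b, f u := by
  rcases hab.eq_or_lt with rfl | hlt
  · simp
  have hba : 0 < b - a := sub_pos.2 hlt
  -- the chord `L u = f a + k (u − a)`, `k = (f b − f a)/(b − a)`, lies below `f` on `[a,b]`
  set k : ℝ := (f b - f a) / (b - a) with hk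
  have hchord : ∀ u ∈ Icc a b, f a + k * (u - a) ≤ f u := by
    intro u hu
    have hθ0 : 0 ≤ (u - a) / (b - a) := div_nonneg (sub_nonneg.2 hu.1) hba.le
    have hθ1 : (u - a) / (b - a) ≤ 1 := by rw [div_le_one hba]; linarith [hu.2]
    have h := hc.2 (left_mem_Icc.2 hlt.le) (right_mem_Icc.2 hlt.le) (sub_nonneg.2 hθ1) hθ0 (by ring)
    have eu : (1 - (u - a) / (b - a)) • a + ((u - a) / (b - a)) • b = u := by
      simp only [smul_eq_mul]; field_simp; ring
    rw [eu] at h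
    simp only [smul_eq_mul] at h
    have ek : k * (u - a) = (u - a) / (b - a) * (f b - f a) := by rw [hk]; ring
    rw [ek]; linarith
  -- its integral is the trapezoid
  have hderiv : ∀ u ∈ Set.uIcc a b,
      HasDerivAt (fun u => f a * u + k / 2 * (u - a) ^ 2) (f a + k * (u - a)) u := by
    intro u _
    have h1 : HasDerivAt (fun u : ℝ => f a * u) (f a * 1) u := (hasDerivAt_id u).const_mul (f a)
    have h2 : HasDerivAt (fun u : ℝ => (u - a) ^ 2) (((2 : ℕ) : ℝ) * (u - a) ^ (2 - 1) * 1) u :=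
      ((hasDerivAt_id u).sub_const a).pow 2
    refine (h1.add (h2.const_mul (k / 2))).congr_deriv ?_
    push_cast
    ring
  have hLi : ∫ u in a..b, (f a + k * (u - a)) = (b - a) * (f a + f b) / 2 := by
    rw [integral_eq_sub_of_hasDerivAt hderiv ((continuous_const.add (continuous_const.mul
      (continuous_id.sub continuous_const))).intervalIntegrable a b)]
    rw [hk]; field_simp; ring
  rw [← hLi]
  exact intervalIntegral.integral_mono_on hlt.le ((continuous_const.add (continuous_const.mul
    (continuous_id.sub continuous_const))).intervalIntegrable a b) (hf.intervalIntegrable a b) hchord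

/-- Dually, for `f` continuous and convex on `[a,b]`: `∫_a^b f ≤ (b − a)(f a + f b)/2`. [folklore] -/
theorem integral_le_trapezoid_of_convexOn {f : ℝ → ℝ} {a b : ℝ} (hab : a ≤ b) (hf : Continuous f)
    (hc : ConvexOn ℝ (Icc a b) f) : ∫ u in a..b, f u ≤ (b - a) * (f a + f b) / 2 := by
  have h := trapezoid_le_integral_of_concaveOn hab hf.neg hc.neg
  simp only [Pi.neg_apply, intervalIntegral.integral_neg] at h
  linarith

variable (hXm : Measurable X) (hXb : ∃ C, ∀ ω, |X ω| ≤ C)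
include hXm hXb

/-- **CONCAVE VARIANCE PROFILE ⇒ THE GAUSSIAN MODEL OVER-STATES THE VARIANCE: `Var ΔS ≤ 2⟨ΔS⟩`** (`s ≤ t`,
`u ↦ Var_{μ_u}X` concave on `[s,t]`). [ours] -/
theorem variance_le_two_mul_integral_of_concaveOn {s t : ℝ} (hst : s ≤ t)
    (hc : ConcaveOn ℝ (Icc s t) fun u => variance X (μ.tilted fun ω => u * X ω)) :
    variance (swapLogRatio X s t) ((μ.tilted fun ω => s * X ω).prod (μ.tilted fun ω => t * X ω))
      ≤ 2 * ∫ p, swapLogRatio X s t p ∂((μ.tilted fun ω => s * X ω).prod (μ.tilted fun ω => t * X ω)) := by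
  have h := variance_sub_two_mul_integral_swapLogRatio (μ := μ) hXm hXb s t
  have htrap := trapezoid_le_integral_of_concaveOn hst (continuous_variance_tilted hXm hXb) hc
  have hts : 0 ≤ t - s := sub_nonneg.2 hst
  nlinarith

/-- **CONVEX VARIANCE PROFILE ⇒ THE GAUSSIAN MODEL UNDER-STATES THE VARIANCE: `2⟨ΔS⟩ ≤ Var ΔS`** (`s ≤ t`,
`u ↦ Var_{μ_u}X` convex on `[s,t]`). [ours] -/
theorem two_mul_integral_le_variance_of_convexOn {s t : ℝ} (hst : s ≤ t)
    (hc : ConvexOn ℝ (Icc s t) fun u => variance X (μ.tilted fun ω => u * X ω)) :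
    2 * ∫ p, swapLogRatio X s t p ∂((μ.tilted fun ω => s * X ω).prod (μ.tilted fun ω => t * X ω))
      ≤ variance (swapLogRatio X s t) ((μ.tilted fun ω => s * X ω).prod (μ.tilted fun ω => t * X ω)) := by
  have h := variance_sub_two_mul_integral_swapLogRatio (μ := μ) hXm hXb s t
  have htrap := integral_le_trapezoid_of_convexOn hst (continuous_variance_tilted hXm hXb) hc
  have hts : 0 ≤ t - s := sub_nonneg.2 hst
  nlinarith

/-- **LEADING ORDER OF THE MEAN: `⟨ΔS⟩/(t−s)² → Var_{μ_s}X` as `t → s`** (the slope of `ψ′`). [ours] -/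
theorem tendsto_integral_swapLogRatio_div_sq (s : ℝ) :
    Tendsto (fun t => (∫ p, swapLogRatio X s t p ∂((μ.tilted fun ω => s * X ω).prod (μ.tilted fun ω => t * X ω)))
      / (t - s) ^ 2) (𝓝[≠] s) (𝓝 (variance X (μ.tilted fun ω => s * X ω))) := by
  have hslope := (hasDerivAt_deriv_cgf_of_bounded (μ := μ) hXm hXb s).tendsto_slope
  refine hslope.congr' ?_
  filter_upwards [self_mem_nhdsWithin] with t ht
  rw [integral_swapLogRatio hXm hXb, slope_def_field]
  have hts : t - s ≠ 0 := sub_ne_zero.2 ht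
  field_simp

/-- **LEADING ORDER OF THE VARIANCE: `Var ΔS/(t−s)² → 2·Var_{μ_s}X` as `t → s`** (continuity of the profile). [ours] -/
theorem tendsto_variance_swapLogRatio_div_sq (s : ℝ) :
    Tendsto (fun t => variance (swapLogRatio X s t) ((μ.tilted fun ω => s * X ω).prod (μ.tilted fun ω => t * X ω))
      / (t - s) ^ 2) (𝓝[≠] s) (𝓝 (2 * variance X (μ.tilted fun ω => s * X ω))) := by
  have hc := continuous_variance_tilted (μ := μ) hXm hXb
  have hlim : Tendsto (fun t => variance X (μ.tilted fun ω => s * X ω) + variance X (μ.tilted fun ω => t * X ω))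
      (𝓝[≠] s) (𝓝 (2 * variance X (μ.tilted fun ω => s * X ω))) := by
    have h : Tendsto (fun t => variance X (μ.tilted fun ω => s * X ω) + variance X (μ.tilted fun ω => t * X ω))
        (𝓝[≠] s) (𝓝 (variance X (μ.tilted fun ω => s * X ω) + variance X (μ.tilted fun ω => s * X ω))) :=
      tendsto_const_nhds.add ((hc.tendsto s).mono_left nhdsWithin_le_nhds)
    convert h using 2; ring
  refine hlim.congr' ?_
  filter_upwards [self_mem_nhdsWithin] with t ht
  rw [variance_swapLogRatio hXm hXb]
  have hts : t - s ≠ 0 := sub_ne_zero.2 ht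
  field_simp

/-- **HENCE `Var ΔS/(2⟨ΔS⟩) → 1` AS `t → s` wherever `Var_{μ_s}X > 0`**: between close replicas every linear
tempering family satisfies the one-parameter Gaussian swap relation to leading order. [ours] -/
theorem tendsto_variance_div_two_mul_integral (s : ℝ) (hpos : 0 < variance X (μ.tilted fun ω => s * X ω)) :
    Tendsto (fun t => variance (swapLogRatio X s t) ((μ.tilted fun ω => s * X ω).prod (μ.tilted fun ω => t * X ω))
      / (2 * ∫ p, swapLogRatio X s t p ∂((μ.tilted fun ω => s * X ω).prod (μ.tilted fun ω => t * X ω))))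
      (𝓝[≠] s) (𝓝 1) := by
  have h1 := tendsto_variance_swapLogRatio_div_sq (μ := μ) hXm hXb s
  have h2 := (tendsto_integral_swapLogRatio_div_sq (μ := μ) hXm hXb s).const_mul 2
  have hne : 2 * variance X (μ.tilted fun ω => s * X ω) ≠ 0 := by positivity
  have h := h1.div h2 hne
  rw [div_self hne] at h
  refine h.congr' ?_
  filter_upwards [self_mem_nhdsWithin] with t ht
  have hts : (t - s) ^ 2 ≠ 0 := pow_ne_zero 2 (sub_ne_zero.2 ht)
  simp only [Pi.div_apply]
  rw [← mul_div_assoc, div_div_div_cancel_right₀ hts]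

end Gauss

end Summit.Ventures.LatticeQCDFlow.Scaling

end
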